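/-
Copyright: statement-level skeleton of a published paper (lit-balaban cell, Phase-2 proof seat p10, gen 3). No proof claims
beyond what the kernel checks below.
-/
import Mathlib
import Literature.MathematicalPhysics.QuantumFieldTheory.BalabanImbrieJaffe1984to88.BIJ85Sect7Statements
import Literature.MathematicalPhysics.QuantumFieldTheory.BalabanImbrieJaffe1984to88.BIJ85AveragingSums716
import Literature.MathematicalPhysics.QuantumFieldTheory.BalabanImbrieJaffe1984to88.BIJ85Prop712Fibre

/-!
# `BalabanImbrieJaffe1984to88.BIJ85Thm711Fibrewise` — T. Bałaban, J. Imbrie, A. Jaffe, *Renormalization of the Higgs model: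
minimizers, propagators and the stability of mean field theory*, Commun. Math. Phys. **97** (1985) 299–329
[BalabanImbrieJaffe1985]: Sect. 7.1 pp. 321–325 — **Proposition 7.1.2 and Theorem 7.1.1 (fibrewise form (7.1.22)) for the
CONCRETE momentum-fibre family σ_k(p) = τ₁(p) + τ₂(p) of (7.1.13)–(7.1.16)** — MODEL INSTANCE of r15's `BIJ85Sect7Statements.
Prop712` / `Thm711`, PROVED; with (7.1.23) and its explicit constant

statement-level skeleton of published theorems with citation tags; proofs where landed; nothing here is a claim about
the Yang–Mills mass gap

PDF held: `paper:balaban1985-cmp97-bij-higgs-minimizers` (journal page = PDF page + 298).  Renders read as images: PDF pp.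
23–27 (journal 321–325), `run/shared/lean/pub/pub-balaban/t4/b2b-balaban-t4-lit2/renders/bij1985/…-p023…p027-x2.png`.

CITATION HEADER (lean-in-tree rule).  Part of the lit-balaban TYPED SKELETON (HOME `run/shared/lean/pub/lit-balaban/`); WHAT IS
REPRODUCED: SKELETON rows **C1.Prop7.1.2** (*"Proposition 7.1.2 (7.1.21) … Then Theorem 7.1.1 holds"*, typed `Prop712 (F :
FibreData)` p239582) and **C1.Thm7.1.1** (*"There exists a constant c > 0, independent of k, such that c ≤ σ_k (7.1.1)"*, typed
`Thm711 (fam : ℕ → SigmaForm)` p239582) of `HOME/lit-balaban-r15/ROWS-C1.md` (fold owner r15, referee ref-5), kind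
«model-instance»: the typed Props quantify over ABSTRACT carrier data; here they are PROVED for the concrete datum
`fibreModel d sc` (THE MODEL, below).  File 3/3 of seat p10 gen 3 (file 1 `BIJ85AveragingSums716`: the bounds behind (7.1.23);
file 2 `BIJ85Prop712Fibre`: Proposition 7.1.2 at one fibre).
THE PRINTED TEXT (p. 324 [PDF 26], verbatim): *"Proposition 7.1.2. Suppose there exists ε > 0, and τ₀(p) ≤ τ₁(p) such that for
|p_j| ≤ π, ε ≤ τ₀(p)↾(∂𝒦(p))^⊥ and ε ≤ τ₂(p)↾∂𝒦(p). (7.1.21) Then Theorem 7.1.1 holds. Proof. It is sufficient to show that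
there is a constant c > 0 such that c ≤ σ_k(p) (7.1.22) for all |p_j| ≤ π."*; p. 325 [PDF 27]: *"This completes the proof of
Theorem 7.1.1."*  (The rest of pp. 324–325 is quoted in files 1–2 and in the gen-2 files named below.)

THE MODEL `fibreModel d sc` (a term of r15's `BIJ85Sect7Statements.FibreData`), for a dimension d ≥ 1 and scale data
sc : ℕ → Scale, sc k = (n_k, M_k) with 2M_k + 1 ≤ n_k (η = L^{−k} = 1/n_k; the l-sums of (7.1.10)/(7.1.14)/(7.1.16) over
l = 2πm, |m_i| ≤ M_k = r15's `lShifts d M_k` — for n_k = L^k odd and 2M_k + 1 = n_k exactly the printed range |l_i| ≤ π/η,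
`scaleOdd`): `Mom k` = the momenta p with 0 < |p_i| ≤ π (p. 321 *"|p_i| ≤ π"*; p_i = 0 excluded because r15's typed v_μ(p) =
∂^{(1)}_μ(p′)/∂_μ(p) is the junk value 0 there, print's 1 by continuity — transcript note T10 of ROWS-C1; a Lebesgue-null set,
immaterial under the dp-integral (7.1.2)); `Fib k p` = the two-forms 𝒦(p) (antisymmetric f_{μν}, p. 321); the splitting f = ∂B +
f^⊥ of (7.1.19) = the one chosen from gen-2 `BIJ85CurlComplement719.exists_decomp719_twoForm` (curls with ∂^{(1)}(p), ( , ) of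
(7.1.19b) with v(p); unique by `decomp719_unique`); ‖f^⊥‖², ‖∂B‖² = `normSq`; ⟨f^⊥,τ₀(p)f^⊥⟩ with gen-2 `tau0` (½ the l = 0 term
of (7.1.14)); ⟨∂B,τ₂(p)∂B⟩ with r15's `tau2Sym`; and `sigmaFam k` = the fibrewise form family: carrier Σ_p 𝒦(p), ‖f‖², and
⟨f, σ_k(p)f⟩ := ⟨f, (τ₁(p) + τ₂(p))f⟩ (pairing (7.1.3) `tensorInner`, τ₁ (7.1.14) `tau1Sym`, τ₂ (7.1.15) `tau2Sym` of r15).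
So `Thm711 (fibreModel d sc).sigmaFam` IS (7.1.22): ∃ c > 0 ∀ k ∀ p ∀ f ∈ 𝒦(p), c‖f‖² ≤ ⟨f,σ_k(p)f⟩.

WHAT IS KERNEL-CHECKED (zero `sorry`, standard axioms):
* **(7.1.23)** |a_μ(p)|² ≤ c₂²φ_ν(p) for all μ, ν, k, p of the model, c₂² = `cTwoSq d` = 2(π/2)^{2d+2}(1 + ¼K₀^{2d}dπ²),
  K₀ = 1 + Σ_{j∈ℤ}1/j² (`ineq7123_sq`; printed form `ineq7123`) — from file 1;
* **Proposition 7.1.2** for the model: `prop712_fibreModel : Prop712 (fibreModel d sc)`, proved AS PRINT PROVES IT — from the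
  hypothesis (7.1.21) via (7.1.23) ⇒ (7.1.24) ⇒ file 2's `prop712_fibre` ((7.1.25)–(7.1.27) = r15's `prop712_core`), with
  c = ¼·min{1,(ε/2M)²}·ε, M = d·c₂² (the printed ½δε halved: we bound ‖f‖² ≤ 2(‖∂B‖² + ‖f^⊥‖²) instead of using the
  ( , )-orthogonality of (7.1.19b));
* **(7.1.21) VERIFIED** for the model with ε = ½(2/π)^{2d+4} (`ineq7121_fibreModel`): on (∂𝒦)^⊥ by gen-2 (7.1.28)–(7.1.30)
  (`BIJ85Tau0Positivity729.ineq7130`); on ∂𝒦 by (7.1.31) and the p. 325 display (gen-2 `BIJ85SigmaOnCurls325.eq325_tau2_general`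
  + `lower_bound_eps`, the [6I]-type sandwich (2/π)^{2d+4} ≤ Δ^{(1)}(p)φ_μ(p) ≤ Σ_l|u(p + l)|² being PROVED here, `lapOne_phiSym_bounds`);
* **Theorem 7.1.1, fibrewise**: `thm711_fibreModel : Thm711 (fibreModel d sc).sigmaFam`, and `thm711_explicit` with the constant
  c(d) = ¼·min{1,(ε/2dc₂²)²}·ε, ε = ½(2/π)^{2d+4} — depending on d only: *"independent of k"* (and of p, L, n_k, M_k).
NOT CLAIMED: (7.1.2) (Plancherel on the unit torus of T^{(k)}) and hence (7.1.1) for the configuration-space operator σ_k of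
(4.2.2)/(7.1.12); the identification (7.1.13) of τ₁ + τ₂ with Q^e_k(I − ∂G_{k,Ax}∂^*)Q^{e*}_k (*"straightforward, algebraic
manipulation"* from [6I] (1.83)–(1.84)) — rows C1.Eq7.1.2-7.1.12 / C1.Eq7.1.13-7.1.19 record both as not reproduced; momenta
with a vanishing component (above).  Unit `lit-balaban-p10` (gen 3), HOME as above.
-/

namespace Literature.MathematicalPhysics.QuantumFieldTheory.BalabanImbrieJaffe1984to88.BIJ85Thm711Fibrewise

open scoped BigOperators Real ComplexConjugate
open Finset
open Literature.MathematicalPhysics.QuantumFieldTheory.BalabanImbrieJaffe1984to88.BIJ85MomentumSymbols71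
open Literature.MathematicalPhysics.QuantumFieldTheory.BalabanImbrieJaffe1984to88.BIJ85CurlComplement719
open Literature.MathematicalPhysics.QuantumFieldTheory.BalabanImbrieJaffe1984to88.BIJ85Tau0Positivity729
open Literature.MathematicalPhysics.QuantumFieldTheory.BalabanImbrieJaffe1984to88.BIJ85Tau2Kernel715
open Literature.MathematicalPhysics.QuantumFieldTheory.BalabanImbrieJaffe1984to88.BIJ85SigmaOnCurls325
open Literature.MathematicalPhysics.QuantumFieldTheory.BalabanImbrieJaffe1984to88.BIJ85AveragingSums716
open Literature.MathematicalPhysics.QuantumFieldTheory.BalabanImbrieJaffe1984to88.BIJ85Prop712Fibre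
open Literature.MathematicalPhysics.QuantumFieldTheory.BalabanImbrieJaffe1984to88.BIJ85Sect7Statements

noncomputable section

variable {d : ℕ}

/-! ## §1 (7.1.23) with its constant -/

/-- The constant of (7.1.23): c₂² = 2(π/2)^{2d+2}(1 + ¼K₀^{2d}·dπ²), depending on d only.
[cite: BalabanImbrieJaffe1985, (7.1.23) p.324] -/
def cTwoSq (d : ℕ) : ℝ := 2 * (π / 2) ^ (2 * d + 2) * (1 + 1 / 4 * (1 + ∑' j : ℤ, 1 / (j : ℝ) ^ 2) ^ (2 * d) * (d * π ^ 2))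

/-- c₂² > 0. [cite: BalabanImbrieJaffe1985, (7.1.23) p.324] -/
theorem cTwoSq_pos (d : ℕ) : 0 < cTwoSq d := by
  have := one_le_kay; unfold cTwoSq; positivity

/-- **(7.1.23)** p. 324 [PDF 26], verbatim: *"The inequality |a_μ(p)/φ_ν(p)^{1/2}| ≤ c₂ (7.1.23) is an extension of
(7.1.20)."* — PROVED in the squared form |a_μ(p)|² ≤ c₂²φ_ν(p) for ALL μ, ν, with c₂² = `cTwoSq d` independent of p, k (n) and
the cut-off: η = 1/n, 2M + 1 ≤ n, 0 < |p_i| ≤ π, d ≥ 1.  Route (not printed): φ_ν ≥ (2/π)^{2d+2}/Δ (`phiSym_ge`), |a_μ| ≤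
|∂^{(1)}_μ|(1/Δ + ¼K₀^d) (`norm_aSym_le`), |∂^{(1)}_μ|² ≤ Δ ≤ dπ², |∂^{(1)}_μ|² ≤ 4. [cite: BalabanImbrieJaffe1985, (7.1.23) p.324] -/
theorem ineq7123_sq {n M : ℕ} (hMn : 2 * M + 1 ≤ n) (hd : 0 < d) {p : Fin d → ℝ} (hp : ∀ i, p i ≠ 0 ∧ |p i| ≤ π)
    (μ ν : Fin d) : ‖aSym ((n : ℝ)⁻¹) M p μ‖ ^ 2 ≤ cTwoSq d * phiSym ((n : ℝ)⁻¹) M p ν := by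
  have hn : 0 < n := by omega
  have hn' : (0 : ℝ) < n := by exact_mod_cast hn
  have hη0 : 0 < ((n : ℝ)⁻¹) := inv_pos.mpr hn'
  have hη1 : ((n : ℝ)⁻¹) ≤ 1 := inv_le_one_of_one_le₀ (by exact_mod_cast hn)
  have hΔ : 0 < lapSym ((n : ℝ)⁻¹) p := by simpa only [shiftMom_zero] using lapSym_shift_pos hn hd hp 0
  set Δ := lapSym ((n : ℝ)⁻¹) p with hΔdef
  set C := 1 / 4 * (1 + ∑' j : ℤ, 1 / (j : ℝ) ^ 2) ^ d with hC
  set e := ‖dOne p μ‖ with he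
  have hC0 : 0 ≤ C := by rw [hC]; have := one_le_kay; positivity
  have ha := norm_aSym_le hMn hp μ
  have hφ := phiSym_ge hη0 hη1 M hp hΔ ν
  have he2Δ : e ^ 2 ≤ Δ := norm_dOne_sq_le_lapSym hn p μ
  have he4 : e ^ 2 ≤ 4 := by nlinarith [norm_dOne_le_two p μ, norm_nonneg (dOne p μ)]
  have hΔle : Δ ≤ d * π ^ 2 := lapSym_le hn fun i => (hp i).2
  have hd1 : (1 : ℝ) ≤ d := by exact_mod_cast hd
  -- |a|² ≤ e²(Δ⁻¹ + C)² ≤ 2e²(Δ⁻² + C²)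
  have h1 : ‖aSym ((n : ℝ)⁻¹) M p μ‖ ^ 2 ≤ e ^ 2 * (Δ⁻¹ + C) ^ 2 := by
    rw [← mul_pow]; exact pow_le_pow_left₀ (norm_nonneg _) ha 2
  have h2 : e ^ 2 * (Δ⁻¹ + C) ^ 2 ≤ 2 * (e ^ 2 * Δ⁻¹ * Δ⁻¹ + e ^ 2 * C ^ 2) := by
    nlinarith [sq_nonneg (Δ⁻¹ - C), sq_nonneg e]
  -- e²Δ⁻² ≤ Δ⁻¹ and e²C² ≤ 4C² ≤ 4C²·dπ²·Δ⁻¹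
  have h3 : e ^ 2 * Δ⁻¹ * Δ⁻¹ ≤ Δ⁻¹ := by
    have : e ^ 2 * Δ⁻¹ ≤ 1 := by rw [← div_eq_mul_inv, div_le_one hΔ]; exact he2Δ
    calc e ^ 2 * Δ⁻¹ * Δ⁻¹ ≤ 1 * Δ⁻¹ := mul_le_mul_of_nonneg_right this (inv_nonneg.mpr hΔ.le)
      _ = Δ⁻¹ := one_mul _
  have h4 : e ^ 2 * C ^ 2 ≤ 4 * C ^ 2 * (d * π ^ 2) * Δ⁻¹ := by
    have h5 : 1 ≤ (d * π ^ 2) * Δ⁻¹ := by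
      rw [← div_eq_mul_inv, le_div_iff₀ hΔ, one_mul]; exact hΔle
    nlinarith [sq_nonneg C, mul_nonneg (mul_nonneg (by norm_num : (0:ℝ) ≤ 4) (sq_nonneg C)) (sub_nonneg.mpr h5)]
  -- assemble: |a|² ≤ 2(1 + 4C²dπ²)Δ⁻¹ = c₂²·(2/π)^{2d+2}Δ⁻¹ ≤ c₂² φ
  have h6 : ‖aSym ((n : ℝ)⁻¹) M p μ‖ ^ 2 ≤ 2 * (1 + 4 * C ^ 2 * (d * π ^ 2)) * Δ⁻¹ := by nlinarith
  have h7 : 2 * (1 + 4 * C ^ 2 * (d * π ^ 2)) * Δ⁻¹ = cTwoSq d * ((2 / π) ^ (2 * d + 2) * Δ⁻¹) := by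
    have hπ : (π / 2) ^ (2 * d + 2) * (2 / π) ^ (2 * d + 2) = 1 := by
      rw [← mul_pow, show π / 2 * (2 / π) = 1 by field_simp, one_pow]
    have hk : (1 + ∑' j : ℤ, 1 / (j : ℝ) ^ 2) ^ (2 * d) = ((1 + ∑' j : ℤ, 1 / (j : ℝ) ^ 2) ^ d) ^ 2 := by rw [← pow_mul, mul_comm]
    calc 2 * (1 + 4 * C ^ 2 * (d * π ^ 2)) * Δ⁻¹
        = 2 * ((π / 2) ^ (2 * d + 2) * (2 / π) ^ (2 * d + 2)) * (1 + 1 / 4 * (1 + ∑' j : ℤ, 1 / (j : ℝ) ^ 2) ^ (2 * d) * (d * π ^ 2)) * Δ⁻¹ := by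
          rw [hπ, hC, hk]; ring
      _ = cTwoSq d * ((2 / π) ^ (2 * d + 2) * Δ⁻¹) := by rw [cTwoSq]; ring
  rw [h7] at h6
  exact h6.trans (mul_le_mul_of_nonneg_left hφ (cTwoSq_pos d).le)

/-- **(7.1.23)** in the printed form: |a_μ(p)/φ_ν(p)^{1/2}| ≤ c₂ with c₂ = √`cTwoSq d` (same hypotheses).
[cite: BalabanImbrieJaffe1985, (7.1.23) p.324] -/
theorem ineq7123 {n M : ℕ} (hMn : 2 * M + 1 ≤ n) (hd : 0 < d) {p : Fin d → ℝ} (hp : ∀ i, p i ≠ 0 ∧ |p i| ≤ π)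
    (μ ν : Fin d) : ‖aSym ((n : ℝ)⁻¹) M p μ‖ / Real.sqrt (phiSym ((n : ℝ)⁻¹) M p ν) ≤ Real.sqrt (cTwoSq d) := by
  have hn : 0 < n := by omega
  have hn' : (0 : ℝ) < n := by exact_mod_cast hn
  have hΔ : 0 < lapSym ((n : ℝ)⁻¹) p := by simpa only [shiftMom_zero] using lapSym_shift_pos hn hd hp 0
  have hφ : 0 < phiSym ((n : ℝ)⁻¹) M p ν :=
    phiSym_pos (inv_pos.mpr hn') (inv_le_one_of_one_le₀ (by exact_mod_cast hn)) M hp hΔ ν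
  rw [div_le_iff₀ (Real.sqrt_pos.mpr hφ), ← Real.sqrt_mul (cTwoSq_pos d).le]
  exact (Real.le_sqrt (norm_nonneg _) (mul_nonneg (cTwoSq_pos d).le hφ.le)).mpr (ineq7123_sq hMn hd hp μ ν)

/-! ## §2 The model: generic momenta, two-forms, the splitting (7.1.19), σ_k(p) = τ₁(p) + τ₂(p) -/

/-- The momenta of the model: p. 321 *"The momenta p have d components p_i, and |p_i| ≤ π"*, with p_i ≠ 0 (r15's typed v_μ(p)
is the junk value 0 at p_μ = 0 — transcript note T10; the excluded set is Lebesgue-null). [cite: BalabanImbrieJaffe1985, (7.1.2) p.321] -/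
def Mom (d : ℕ) : Type := {p : Fin d → ℝ // ∀ i, p i ≠ 0 ∧ |p i| ≤ π}

/-- The fibre 𝒦(p): p. 321 *"functions f_{μν} on plaquettes given as antisymmetric functions on coordinate axes μ, ν"* at
momentum p (gen-2 `IsTwoForm`). [cite: BalabanImbrieJaffe1985, (7.1.19) p.323] -/
def TwoForm (d : ℕ) : Type := {f : Fin d → Fin d → ℂ // IsTwoForm f}

/-- Scale data of the model at scale k: η = L^{−k} = 1/n (p. 322 *"|p_i| ≤ π/η = πL^k"*) and the cut-off M of r15's index set
`lShifts d M` (l = 2πm, |m_i| ≤ M) with 2M + 1 ≤ n; for n odd and 2M + 1 = n this is the printed range *"l ∈ 2πZ^d, |l_i| ≤ π/η"*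
of (7.1.10) (`scaleOdd`). [cite: BalabanImbrieJaffe1985, (7.1.10) p.322] -/
structure Scale where
  /-- n = L^k = η⁻¹ -/
  n : ℕ
  /-- the cut-off |m_i| ≤ M of the l-sums -/
  M : ℕ
  /-- 2M + 1 ≤ n -/
  le : 2 * M + 1 ≤ n

/-- η = 1/n. [cite: BalabanImbrieJaffe1985, (7.1.4) p.322] -/
def Scale.eta (s : Scale) : ℝ := ((s.n : ℝ)⁻¹)

/-- The printed scales: n = L^k and M = (L^k − 1)/2 (integer part; = the printed range exactly when L is odd), L ≥ 1.
[cite: BalabanImbrieJaffe1985, (7.1.10) p.322] -/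
def scaleOdd (L : ℕ) (hL : 1 ≤ L) (k : ℕ) : Scale where
  n := L ^ k
  M := (L ^ k - 1) / 2
  le := by have := Nat.one_le_pow k L hL; omega

/-- **(7.1.19a)**, the splitting f = ∂B + f^⊥ of a two-form at momentum p (curls with ∂^{(1)}(p), complement for the product
(7.1.19b) with the eigenvalues v(p) at spacing η): existence is gen-2 `exists_decomp719_twoForm` (uniqueness `decomp719_unique`).
[cite: BalabanImbrieJaffe1985, (7.1.19a) p.323] -/
theorem decomp_exists (η : ℝ) (p : Fin d → ℝ) (f : TwoForm d) :
    ∃ Bg : (Fin d → ℂ) × (Fin d → Fin d → ℂ),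
      f.1 = curlP (dOne p) Bg.1 + Bg.2 ∧ PerpCurl (dOne p) (vSym η p) Bg.2 ∧ IsTwoForm Bg.2 := by
  obtain ⟨B, g, h1, h2, h3⟩ := exists_decomp719_twoForm (dOne p) (vSym η p) f.2
  exact ⟨(B, g), h1, h2, h3⟩

/-- The chosen pair (B, f^⊥) of the splitting (7.1.19a). [cite: BalabanImbrieJaffe1985, (7.1.19a) p.323] -/
def decomp (η : ℝ) (p : Fin d → ℝ) (f : TwoForm d) : (Fin d → ℂ) × (Fin d → Fin d → ℂ) :=
  Classical.choose (decomp_exists η p f)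

/-- f = ∂B + f^⊥, f^⊥ ∈ (∂𝒦(p))^⊥, f^⊥ ∈ 𝒦(p). [cite: BalabanImbrieJaffe1985, (7.1.19a) p.323] -/
theorem decomp_spec (η : ℝ) (p : Fin d → ℝ) (f : TwoForm d) :
    f.1 = curlP (dOne p) (decomp η p f).1 + (decomp η p f).2 ∧ PerpCurl (dOne p) (vSym η p) (decomp η p f).2 ∧
      IsTwoForm (decomp η p f).2 :=
  Classical.choose_spec (decomp_exists η p f)

/-- The curl part ∂B of f (= r15's `curlOne p B`). [cite: BalabanImbrieJaffe1985, (7.1.19a) p.323] -/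
def curlPart (η : ℝ) (p : Fin d → ℝ) (f : TwoForm d) : Fin d → Fin d → ℂ := curlOne p (decomp η p f).1
/-- The orthogonal part f^⊥ of f. [cite: BalabanImbrieJaffe1985, (7.1.19a) p.323] -/
def perpPart (η : ℝ) (p : Fin d → ℝ) (f : TwoForm d) : Fin d → Fin d → ℂ := (decomp η p f).2

/-- f = ∂B + f^⊥. [cite: BalabanImbrieJaffe1985, (7.1.19a) p.323] -/
theorem eq_curlPart_add_perpPart (η : ℝ) (p : Fin d → ℝ) (f : TwoForm d) :
    f.1 = curlPart η p f + perpPart η p f :=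
  (decomp_spec η p f).1

/-- **σ_k(p) := τ₁(p) + τ₂(p)**, the right-hand side of (7.1.13) with τ₁ (7.1.14), τ₂ (7.1.15)–(7.1.16) as typed by r15 (`tau1Sym`,
`tau2Sym`) at η and cut-off M (so `Eq7113 η M (sigmaSym η M)` holds by `rfl`); the identification with Q^e_k(I − ∂G_{k,Ax}∂^*)Q^{e*}_k
(7.1.12) is NOT reproduced. [cite: BalabanImbrieJaffe1985, (7.1.13) p.322] -/
def sigmaSym (η : ℝ) (M : ℕ) (p : Fin d → ℝ) : Fin d → Fin d → Fin d → Fin d → ℂ :=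
  fun μ ν l κ => tau1Sym η M p μ ν l κ + tau2Sym η M p μ ν l κ

/-- (7.1.13) for the model's σ_k(p), by definition. [cite: BalabanImbrieJaffe1985, (7.1.13) p.322] -/
theorem eq7113_sigmaSym (η : ℝ) (M : ℕ) : Eq7113 η M (sigmaSym (d := d) η M) := fun _ _ _ _ _ => rfl

/-- The fibrewise form family of scale k for `Thm711`: carrier Σ_p 𝒦(p) over the model's momenta, ‖f‖², and ⟨f, σ_k(p)f⟩ (real
part of the pairing (7.1.3); the form is real, τ₁, τ₂ being nonnegative). [cite: BalabanImbrieJaffe1985, (7.1.22) p.324] -/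
def sigmaFormAt (d : ℕ) (s : Scale) : SigmaForm where
  Plaq := Σ _p : Mom d, TwoForm d
  normSq := fun x => normSq x.2.1
  sigma := fun x => (tensorInner x.2.1 (sigmaSym s.eta s.M x.1.1) x.2.1).re

/-- **THE MODEL** of `FibreData` (see the module docstring): momenta 0 < |p_i| ≤ π, fibres 𝒦(p), the splitting (7.1.19) with
‖f^⊥‖², ‖∂B‖², ⟨f^⊥,τ₀(p)f^⊥⟩ (gen-2 `tau0`), ⟨∂B,τ₂(p)∂B⟩ (r15 `tau2Sym`), and the fibrewise family k ↦ σ_k(p) = τ₁(p) + τ₂(p) at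
η = 1/n_k, cut-off M_k. [cite: BalabanImbrieJaffe1985, Prop. 7.1.2 p.324] -/
def fibreModel (d : ℕ) (sc : ℕ → Scale) : FibreData where
  Mom := fun _ => Mom d
  Fib := fun _ _ => TwoForm d
  normSqPerp := fun k p f => normSq (perpPart (sc k).eta p.1 f)
  normSqCurl := fun k p f => normSq (curlPart (sc k).eta p.1 f)
  tau0Perp := fun k p f => (tensorInner (perpPart (sc k).eta p.1 f) (tau0 (sc k).eta p.1) (perpPart (sc k).eta p.1 f)).re
  tau2Curl := fun k p f =>
    (tensorInner (curlPart (sc k).eta p.1 f) (tau2Sym (sc k).eta (sc k).M p.1) (curlPart (sc k).eta p.1 f)).re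
  sigmaFam := fun k => sigmaFormAt d (sc k)

/-! ## §3 Standing facts of the model at a fibre (generic momenta) -/

/-- n ≥ 1, 0 < η ≤ 1. [cite: BalabanImbrieJaffe1985, (7.1.4) p.322] -/
theorem Scale.pos (s : Scale) : 0 < s.n ∧ 0 < s.eta ∧ s.eta ≤ 1 := by
  have hn : 0 < s.n := by have := s.le; omega
  have hn' : (0 : ℝ) < s.n := by exact_mod_cast hn
  exact ⟨hn, inv_pos.mpr hn', inv_le_one_of_one_le₀ (by exact_mod_cast hn)⟩

/-- At a momentum of the model (d ≥ 1): ∂^{(1)}(p) ≠ 0, Δ(p + l) ≠ 0, ∂(p + l) ≠ 0 componentwise (the provisos of r15's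
(7.1.18)), φ(p) > 0 and N(p) = Σ_ρ|∂^{(1)}_ρ(p)|²/φ_ρ(p) ≠ 0. [cite: BalabanImbrieJaffe1985, (7.1.18) p.323] -/
theorem standing (hd : 0 < d) (s : Scale) (p : Mom d) :
    (∀ i, dOne p.1 i ≠ 0) ∧ (∀ m ∈ lShifts d s.M, lapSym s.eta (shiftMom p.1 m) ≠ 0) ∧
      (∀ m ∈ lShifts d s.M, ∀ i, dSym s.eta (shiftMom p.1 m) i ≠ 0) ∧ (∀ μ, 0 < phiSym s.eta s.M p.1 μ) ∧
        enn (dOne p.1) (phiSym s.eta s.M p.1) ≠ 0 := by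
  obtain ⟨hn, hη0, hη1⟩ := s.pos
  have hgen := fun m => generic_shift (d := d) hn p.2 m
  have hΔ0 : 0 < lapSym s.eta p.1 := by simpa only [shiftMom_zero, Scale.eta] using lapSym_shift_pos hn hd p.2 0
  have hφ : ∀ μ, 0 < phiSym s.eta s.M p.1 μ := fun μ => phiSym_pos hη0 hη1 s.M p.2 hΔ0 μ
  refine ⟨fun i => (hgen 0 i).1, fun m _ => (lapSym_shift_pos hn hd p.2 m).ne', fun m _ i => (hgen m i).2.1, hφ, ?_⟩
  refine ne_of_gt (lt_of_lt_of_le ?_ (Finset.single_le_sum (f := fun ρ => ‖dOne p.1 ρ‖ ^ 2 / phiSym s.eta s.M p.1 ρ)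
    (fun ρ _ => div_nonneg (sq_nonneg _) (hφ ρ).le) (Finset.mem_univ ⟨0, hd⟩)))
  exact div_pos (pow_pos (norm_pos_iff.mpr (hgen 0 ⟨0, hd⟩).1) 2) (hφ _)

/-! ## §4 Proposition 7.1.2 for the model -/

/-- The fibrewise lower bound from (7.1.21) at level ε, for THE MODEL: c(ε)‖f‖² ≤ ⟨f,σ_k(p)f⟩ for all k, p, f ∈ 𝒦(p), with
c(ε) = ¼·min{1,(ε/2M)²}·ε, M = d·c₂² — (7.1.23) `ineq7123_sq` ⇒ (7.1.24) ⇒ file 2's `prop712_fibre` ((7.1.25)–(7.1.27)).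
[cite: BalabanImbrieJaffe1985, Prop. 7.1.2 p.324] -/
theorem sigma_lower_of_ineq7121 (hd : 0 < d) (sc : ℕ → Scale) {ε : ℝ} (hε : 0 < ε) (h21 : Ineq7121 (fibreModel d sc) ε)
    (k : ℕ) (p : Mom d) (f : TwoForm d) :
    1 / 4 * min 1 ((ε / (2 * (d * cTwoSq d))) ^ 2) * ε * normSq f.1
      ≤ (tensorInner f.1 (sigmaSym (sc k).eta (sc k).M p.1) f.1).re := by
  obtain ⟨hp, hΔ, hq, hφ, hN⟩ := standing hd (sc k) p
  have h := h21 k p f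
  rw [eq_curlPart_add_perpPart (sc k).eta p.1 f]
  exact prop712_fibre hp hΔ hq hφ hN (cTwoSq_pos d) (fun l κ => ineq7123_sq (sc k).le hd p.2 l κ) hd hε
    (decomp (sc k).eta p.1 f).1 (perpPart (sc k).eta p.1 f) h.1 h.2

/-- **Proposition 7.1.2** p. 324 [PDF 26] for THE MODEL — r15's `BIJ85Sect7Statements.Prop712 (fibreModel d sc)` PROVED as
print proves it: (∃ ε > 0, (7.1.21)) ⇒ Theorem 7.1.1 in the fibrewise form (7.1.22), with c = ¼·min{1,(ε/2M)²}·ε, M = d·c₂².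
[cite: BalabanImbrieJaffe1985, Prop. 7.1.2 p.324] -/
theorem prop712_fibreModel (hd : 0 < d) (sc : ℕ → Scale) : Prop712 (fibreModel d sc) := by
  rintro ⟨ε, hε, h21⟩
  have hM : 0 < (d : ℝ) * cTwoSq d := mul_pos (by exact_mod_cast hd) (cTwoSq_pos d)
  refine ⟨1 / 4 * min 1 ((ε / (2 * (d * cTwoSq d))) ^ 2) * ε,
    mul_pos (mul_pos (by norm_num) (lt_min zero_lt_one (by positivity))) hε, fun k x => ?_⟩
  obtain ⟨p, f⟩ := x
  exact sigma_lower_of_ineq7121 hd sc hε h21 k p f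

/-! ## §5 (7.1.21) verified for the model: (7.1.28)–(7.1.31), end of the proof of Theorem 7.1.1 -/

/-- The [6I]-type sandwich behind *"bounded below by ε‖∂B‖² (see also [6I, 8])"* (p. 325), PROVED for the model:
(2/π)^{2d+4} ≤ Δ^{(1)}(p)φ_μ(p) ≤ Σ_l|u(p + l)|² — lower bound from the l = 0 term and (7.1.20) (`phiSym_ge`, |∂^{(1)}_ρ| ≥ (2/π)|∂_ρ|),
upper bound from |v_μ(p + l)| ≤ 1 and Δ^{(1)}(p) ≤ Δ(p + l). [cite: BalabanImbrieJaffe1985, (7.1.31) p.325] -/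
theorem lapOne_phiSym_bounds (hd : 0 < d) (s : Scale) (p : Mom d) (μ : Fin d) :
    (2 / π) ^ (2 * d + 4) ≤ (∑ ρ, ‖dOne p.1 ρ‖ ^ 2) * phiSym s.eta s.M p.1 μ ∧
      (∑ ρ, ‖dOne p.1 ρ‖ ^ 2) * phiSym s.eta s.M p.1 μ ≤ ∑ m ∈ lShifts d s.M, ‖uSym s.eta (shiftMom p.1 m)‖ ^ 2 := by
  obtain ⟨hn, hη0, hη1⟩ := s.pos
  have hp0 : ∀ i, p.1 i ≠ 0 := fun i => (p.2 i).1
  have hpπ : ∀ i, |p.1 i| ≤ π := fun i => (p.2 i).2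
  have hΔ0 : 0 < lapSym s.eta p.1 := by simpa only [shiftMom_zero, Scale.eta] using lapSym_shift_pos hn hd p.2 0
  set D := ∑ ρ, ‖dOne p.1 ρ‖ ^ 2 with hD
  constructor
  · -- D ≥ (2/π)² Δ(p) and φ_μ(p) ≥ (2/π)^{2d+2}/Δ(p)
    have h1 : (2 / π) ^ 2 * lapSym s.eta p.1 ≤ D := by
      rw [hD, lapSym, Finset.mul_sum]
      refine Finset.sum_le_sum fun ρ _ => ?_
      rw [dOne_eq_vSym_mul_dSym hη0 hη1 (hp0 ρ) (hpπ ρ), norm_mul, mul_pow]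
      exact mul_le_mul_of_nonneg_right
        (pow_le_pow_left₀ (by positivity) (norm_vSym_bounds hη0 hη1 (hp0 ρ) (hpπ ρ)).1 2) (sq_nonneg _)
    have h2 := phiSym_ge hη0 hη1 s.M p.2 hΔ0 μ
    have hΔ1 : lapSym s.eta p.1 * (lapSym s.eta p.1)⁻¹ = 1 := mul_inv_cancel₀ hΔ0.ne'
    calc (2 / π) ^ (2 * d + 4) = (2 / π) ^ 2 * (2 / π) ^ (2 * d + 2) * (lapSym s.eta p.1 * (lapSym s.eta p.1)⁻¹) := by
          rw [hΔ1, mul_one, ← pow_add]; ring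
      _ = ((2 / π) ^ 2 * lapSym s.eta p.1) * ((2 / π) ^ (2 * d + 2) * (lapSym s.eta p.1)⁻¹) := by ring
      _ ≤ D * phiSym s.eta s.M p.1 μ := mul_le_mul h1 h2 (by positivity) (by positivity)
  · -- D·φ_μ = Σ_l |u|²·(|v_μ|²·D/Δ)(p + l) ≤ Σ_l |u(p + l)|²
    rw [phiSym, Finset.mul_sum]
    refine Finset.sum_le_sum fun m _ => ?_
    set q := shiftMom p.1 m
    have hΔq : 0 < lapSym s.eta q := lapSym_shift_pos hn hd p.2 m
    have hDq : D ≤ lapSym s.eta q := by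
      rw [hD, lapSym]
      refine Finset.sum_le_sum fun ρ _ => pow_le_pow_left₀ (norm_nonneg _) ?_ 2
      rw [← dOne_shiftMom p.1 m ρ]
      exact norm_dOne_le_norm_dSym hn q ρ
    have hv := norm_vSym_le_one hn q μ
    have hv0 := norm_nonneg (vSym s.eta q μ)
    rw [norm_mul, mul_pow]
    calc D * (‖uSym s.eta q‖ ^ 2 * ‖vSym s.eta q μ‖ ^ 2 * (lapSym s.eta q)⁻¹)
        = ‖uSym s.eta q‖ ^ 2 * (‖vSym s.eta q μ‖ ^ 2 * (D * (lapSym s.eta q)⁻¹)) := by ring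
      _ ≤ ‖uSym s.eta q‖ ^ 2 * (1 * 1) := by
          refine mul_le_mul_of_nonneg_left (mul_le_mul (by rw [pow_two]; exact mul_le_one₀ hv hv0 hv) ?_ (by positivity)
            zero_le_one) (sq_nonneg _)
          rw [← div_eq_mul_inv, div_le_one hΔq]
          exact hDq
      _ = ‖uSym s.eta q‖ ^ 2 := by ring

/-- **(7.1.21) holds for THE MODEL with ε = ½(2/π)^{2d+4}** (`BIJ85Tau0Positivity729.eps730`), i.e. the hypothesis of
Proposition 7.1.2 VERIFIED, uniformly in k and p: on (∂𝒦)^⊥ by (7.1.28)–(7.1.30) (gen-2 `ineq7130`); on ∂𝒦 by (7.1.31) and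
the explicit formula of p. 325 (gen-2 `eq325_tau2_general`: ⟨∂B,τ₂∂B⟩ = U²·½N^{−1}Σ|(∂B)_{μν}|²/(φ_μφ_ν), U = Σ_l|u(p + l)|²)
with `lower_bound_eps` and the sandwich `lapOne_phiSym_bounds` (γ₋ = (2/π)^{2d+4}, γ₊ = U, which cancels).
[cite: BalabanImbrieJaffe1985, (7.1.30)–(7.1.31) p.325] -/
theorem ineq7121_fibreModel (hd : 0 < d) (sc : ℕ → Scale) : Ineq7121 (fibreModel d sc) (eps730 d) := by
  intro k p f
  obtain ⟨hn, hη0, hη1⟩ := (sc k).pos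
  obtain ⟨hp, hΔ, hq, hφ, hN⟩ := standing hd (sc k) p
  have hp0 : ∀ i, p.1 i ≠ 0 := fun i => (p.2 i).1
  have hpπ : ∀ i, |p.1 i| ≤ π := fun i => (p.2 i).2
  obtain ⟨-, hperp, hg⟩ := decomp_spec (sc k).eta p.1 f
  constructor
  · -- (7.1.28)–(7.1.30) on (∂𝒦)^⊥
    exact ineq7130 hη0 hη1 hp0 hpπ hg hperp
  · -- (7.1.31) on ∂𝒦
    change eps730 d * normSq (curlOne p.1 (decomp (sc k).eta p.1 f).1) ≤
      (tensorInner (curlOne p.1 (decomp (sc k).eta p.1 f).1) (tau2Sym (sc k).eta (sc k).M p.1)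
        (curlOne p.1 (decomp (sc k).eta p.1 f).1)).re
    set B := (decomp (sc k).eta p.1 f).1
    set U := ∑ m ∈ lShifts d (sc k).M, ‖uSym (sc k).eta (shiftMom p.1 m)‖ ^ 2 with hU
    have hsand := fun μ => lapOne_phiSym_bounds hd (sc k) p μ
    have hUpos : 0 < U := lt_of_lt_of_le (by positivity) (((hsand ⟨0, hd⟩).1).trans (hsand ⟨0, hd⟩).2)
    have hD : 0 < ∑ ρ, ‖dOne p.1 ρ‖ ^ 2 :=
      lt_of_lt_of_le (pow_pos (norm_pos_iff.mpr (hp ⟨0, hd⟩)) 2)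
        (Finset.single_le_sum (f := fun ρ => ‖dOne p.1 ρ‖ ^ 2) (fun _ _ => sq_nonneg _) (Finset.mem_univ _))
    have hlow := lower_bound_eps (by positivity : (0 : ℝ) < (2 / π) ^ (2 * d + 4)) hD hsand (curlOne p.1 B)
    rw [eq325_tau2_general (sc k).eta (sc k).M p.1 hφ hN hΔ hq B, Complex.ofReal_re, ← hU]
    have hrw : eps730 d * normSq (curlOne p.1 B)
        = U ^ 2 * ((2 / π) ^ (2 * d + 4) / (2 * U ^ 2) * ∑ μ, ∑ ν, ‖curlOne p.1 B μ ν‖ ^ 2) := by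
      unfold eps730 normSq
      field_simp
    rw [hrw]
    exact mul_le_mul_of_nonneg_left hlow (sq_nonneg U)

/-! ## §6 Theorem 7.1.1, fibrewise -/

/-- **Theorem 7.1.1** p. 321 [PDF 23], verbatim: *"There exists a constant c > 0, independent of k, such that c ≤ σ_k. (7.1.1)"*
— PROVED in the fibrewise form (7.1.22) (*"it is sufficient to show that there is a constant c > 0 such that c ≤ σ_k(p) for all
|p_j| ≤ π"*) for THE MODEL: r15's `BIJ85Sect7Statements.Thm711 (fibreModel d sc).sigmaFam`, i.e. ∃ c > 0 ∀ k ∀ p (0 < |p_i| ≤ π)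
∀ f ∈ 𝒦(p), c‖f‖² ≤ ⟨f, (τ₁(p) + τ₂(p))f⟩ — by Proposition 7.1.2 (`prop712_fibreModel`) and the verification of (7.1.21)
(`ineq7121_fibreModel`).  NOT the operator statement (7.1.1) on T^{(k)} (Plancherel (7.1.2) is not typed).
[cite: BalabanImbrieJaffe1985, Thm. 7.1.1 p.321] -/
theorem thm711_fibreModel (hd : 0 < d) (sc : ℕ → Scale) : Thm711 (fibreModel d sc).sigmaFam :=
  prop712_fibreModel hd sc ⟨eps730 d, eps730_pos d, ineq7121_fibreModel hd sc⟩

/-- Theorem 7.1.1 for the printed scales η = L^{−k}, l-range |m_i| ≤ (L^k − 1)/2 (`scaleOdd`; any L ≥ 1, d ≥ 1).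
[cite: BalabanImbrieJaffe1985, Thm. 7.1.1 p.321] -/
theorem thm711_scaleOdd (hd : 0 < d) {L : ℕ} (hL : 1 ≤ L) : Thm711 (fibreModel d (scaleOdd L hL)).sigmaFam :=
  thm711_fibreModel hd (scaleOdd L hL)

/-- **Theorem 7.1.1 with the explicit constant**: for every k, every momentum 0 < |p_i| ≤ π and every f ∈ 𝒦(p),
c(d)·‖f‖² ≤ ⟨f,σ_k(p)f⟩ with c(d) = ¼·min{1,(ε/2dc₂²)²}·ε, ε = ½(2/π)^{2d+4}, c₂² = `cTwoSq d` — a constant depending on d only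
(*"independent of k"*; also of p, L, n_k, M_k). [cite: BalabanImbrieJaffe1985, Thm. 7.1.1 p.321] -/
theorem thm711_explicit (hd : 0 < d) (sc : ℕ → Scale) (k : ℕ) (p : Mom d) (f : TwoForm d) :
    1 / 4 * min 1 ((eps730 d / (2 * (d * cTwoSq d))) ^ 2) * eps730 d * normSq f.1
      ≤ (tensorInner f.1 (sigmaSym (sc k).eta (sc k).M p.1) f.1).re :=
  sigma_lower_of_ineq7121 hd sc (eps730_pos d) (ineq7121_fibreModel hd sc) k p f

/-! ## v1.1 (append-only): σ_k(p) is a Hermitian form (the real part taken in `sigmaFormAt` loses nothing), and the closed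
form K₀ = 1 + π²/3 of the constant -/

/-- The (ν,κ) factor W of τ₂ (7.1.15) is Hermitian: \overline{W_{νκ}} = W_{κν}. [cite: BalabanImbrieJaffe1985, (7.1.15) p.323] -/
theorem wMat_conj_symm (e : Fin d → ℂ) (φ : Fin d → ℝ) (ν κ : Fin d) : conj (wMat e φ ν κ) = wMat e φ κ ν := by
  simp only [wMat, map_mul, map_sub, map_div₀, map_inv₀, Complex.conj_ofReal, Complex.conj_conj, mul_comm (φ κ) (φ ν),
    apply_ite conj, map_one, map_zero]
  by_cases h : ν = κ
  · subst h; simp [mul_comm]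
  · rw [if_neg h, if_neg (Ne.symm h)]; ring

/-- **τ₂(p′) (7.1.15) is a Hermitian kernel**: \overline{τ_{2,μνλκ}} = τ_{2,λκμν} (generic data). [cite: BalabanImbrieJaffe1985, (7.1.15) p.323] -/
theorem tau2Kernel_conj_symm (a e : Fin d → ℂ) (φ : Fin d → ℝ) (μ ν l κ : Fin d) :
    conj (tau2Kernel a e φ μ ν l κ) = tau2Kernel a e φ l κ μ ν := by
  rw [tau2Kernel_eq_wMat, tau2Kernel_eq_wMat, map_mul, map_mul, Complex.conj_conj, wMat_conj_symm]
  ring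

/-- τ₂(p′) of r15 is Hermitian. [cite: BalabanImbrieJaffe1985, (7.1.15) p.323] -/
theorem tau2Sym_conj_symm (η : ℝ) (M : ℕ) (p' : Fin d → ℝ) (μ ν l κ : Fin d) :
    conj (tau2Sym η M p' μ ν l κ) = tau2Sym η M p' l κ μ ν := by
  rw [tau2Sym_eq_kernel, tau2Kernel_conj_symm]

/-- **σ_k(p) = τ₁(p) + τ₂(p) is a Hermitian kernel**, so the pairing ⟨f,σ_k(p)f⟩ (7.1.3) is a REAL number for every f: the real
part taken in `sigmaFormAt` discards nothing. [cite: BalabanImbrieJaffe1985, (7.1.13) p.322] -/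
theorem sigmaSym_form_im (η : ℝ) (M : ℕ) (p : Fin d → ℝ) (f : Fin d → Fin d → ℂ) :
    (tensorInner f (sigmaSym η M p) f).im = 0 := by
  have hT : ∀ μ ν l κ, conj (sigmaSym η M p μ ν l κ) = sigmaSym η M p l κ μ ν := fun μ ν l κ => by
    simp only [sigmaSym, map_add, tau1Sym_conj_symm, tau2Sym_conj_symm]
  have h := tensorInner_conj_symm hT f f
  exact Complex.conj_eq_iff_im.mp h

/-- Σ_{j∈ℤ} 1/j² = π²/3 (the j = 0 term is Lean's 1/0² = 0): twice ζ(2) = π²/6 (Euler). [folklore] -/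
private theorem tsum_one_div_int_sq : ∑' j : ℤ, 1 / (j : ℝ) ^ 2 = π ^ 2 / 3 := by
  have h1 : HasSum (fun n : ℕ => 1 / ((n : ℤ) : ℝ) ^ 2) (π ^ 2 / 6) := by
    simpa using hasSum_zeta_two
  have h2 : HasSum (fun n : ℕ => 1 / (((-((n : ℤ) + 1) : ℤ)) : ℝ) ^ 2) (π ^ 2 / 6) := by
    have h := (hasSum_nat_add_iff' 1).mpr hasSum_zeta_two
    simp only [Finset.range_one, Finset.sum_singleton, Nat.cast_zero, ne_eq, OfNat.ofNat_ne_zero, not_false_eq_true,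
      zero_pow, div_zero, sub_zero] at h
    have e : (fun n : ℕ => 1 / (((-((n : ℤ) + 1) : ℤ)) : ℝ) ^ 2) = fun n : ℕ => 1 / ((n + 1 : ℕ) : ℝ) ^ 2 := by
      funext n; push_cast; ring
    rw [e]; exact h
  have h3 := HasSum.of_nat_of_neg_add_one (f := fun j : ℤ => 1 / (j : ℝ) ^ 2) h1 h2
  rw [h3.tsum_eq]
  ring

/-- The constant of (7.1.23) in closed form: c₂² = 2(π/2)^{2d+2}(1 + ¼(1 + π²/3)^{2d}·dπ²). [cite: BalabanImbrieJaffe1985, (7.1.23) p.324] -/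
theorem cTwoSq_eq (d : ℕ) : cTwoSq d = 2 * (π / 2) ^ (2 * d + 2) * (1 + 1 / 4 * (1 + π ^ 2 / 3) ^ (2 * d) * (d * π ^ 2)) := by
  rw [cTwoSq, tsum_one_div_int_sq]

/-- **Theorem 7.1.1 with the constant in closed form**: c(d)‖f‖² ≤ ⟨f,σ_k(p)f⟩ with
c(d) = ¼·min{1, (ε/(2d·c₂²))²}·ε, ε = ½(2/π)^{2d+4}, c₂² = 2(π/2)^{2d+2}(1 + ¼(1 + π²/3)^{2d}dπ²) — a function of d alone.
[cite: BalabanImbrieJaffe1985, Thm. 7.1.1 p.321] -/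
theorem thm711_closedForm (hd : 0 < d) (sc : ℕ → Scale) (k : ℕ) (p : Mom d) (f : TwoForm d) :
    1 / 4 * min 1 ((eps730 d / (2 * (d * (2 * (π / 2) ^ (2 * d + 2) * (1 + 1 / 4 * (1 + π ^ 2 / 3) ^ (2 * d) * (d * π ^ 2))))))
      ^ 2) * eps730 d * normSq f.1 ≤ (tensorInner f.1 (sigmaSym (sc k).eta (sc k).M p.1) f.1).re := by
  rw [← cTwoSq_eq]
  exact thm711_explicit hd sc k p f

end

end Literature.MathematicalPhysics.QuantumFieldTheory.BalabanImbrieJaffe1984to88.BIJ85Thm711Fibrewise
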